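import Summits.KontsevichZagierPeriods.KontsevichZagierPeriods.Theorems.LinRedNormalFormArrangementNormalFormStubRebaseSimplePosOneFibreParOne
import Summits.KontsevichZagierPeriods.KontsevichZagierPeriods.Theorems.LinRedNormalFormArrangementNormalFormStubRebaseSimplePosOneFibreDouble

/-!
# Stub `stub_rebaseSimplePosOnePos` (crux `ArrangementNormalForm`, line `janus-bands`) —
part `Flats`: the one-fibre rebase over a base of dimension `B + 1 ≥ 3` reduced to the
DEGENERATION FLATS of the silent base

The registered stub `stub_rebaseSimplePosOnePos`
(`GS (b+2) 1 → closure (GG (b+2) 2 1 ∪ JJ (b+2) 2 ∪ JD (b+3))` modulo `KZ.relations`: base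
`(x', y)`, `x' ∈ ℝ^{b+2}`, in a bounded rational polyhedron, base factor `R(x')/(y − ℓ₂(x'))`,
one lettered fibre `t`) through the B-generic one-fibre case tree
`rebaseSimplePos_oneFibre_of_double'` (parallel transverse bands `Hpar` + double-corner bands
`Hdthick`/`Hdfar`). The new B-generic step is on `Hpar` (one fibre, letter `0`, affine bounds
`0 < u < v` PARALLEL in `y`, so that the width `w = v − u` is a `y`-free affine form): after the
product-cell dissection `rebaseSimplePos_par_cells` (cells `{x'-rows} × (ylo(x'), yhi(x'))`,
height `h = yhi − ylo`, again a `y`-free affine form), a cell whose CLOSED cell does not meet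
the flat `{h = 0} ∩ {w = 0}` is closed by the landed tools alone
(`RebasePos.good_parCell_of_noFlat`): by the extreme value theorem on the compact closure of
the (bounded) domain, `max (h, w) ≥ μ > 0` there, so that `w ≥ μ` wherever `h < μ`; one cut at
the rational level `h = δ < μ` (rule 1a) leaves a NON-PINCHING far part `h > δ`
(`rebaseSimplePos_par_nonpinch`) and a near part on which `|u_y| h ≤ |u_y| δ ≤ (N + 1) w`
(`rebaseSimplePos_par_level`: finitely many horizontal strips and level splits). Hence `Hpar`
holds as soon as it holds for the product cells whose closed cell MEETS the flat
(`RebasePos.good_par_of_flat`, registered as `rebaseSimplePos_par_of_flat`; the flat condition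
is the literal `∃ z ∈ closure {rows > 0}, ylo(z) = yhi(z) ∧ u(z) = v(z)`), and the stub holds
as soon as, for every base pole `ℓ`, the FLAT parallel bands (`HparFlat`) and the double-corner
bands (`Hdthick`, `Hdfar`, verbatim from `rebaseSimplePos_oneFibre_of_double'` at `b + 1`) are
congruent to the subgroup generated by `GG (b+2) 2 1`: `rebaseSimplePos_oneFibre_of_flats`
(literal data, registered) and `rebaseSimplePosOnePos_of_flats'` (exactly the stub's signature
plus the three residual hypotheses; target embedded by `AddSubgroup.closure_mono`).

For `B = 1` there is no flat (`h` and `w` are affine in the single silent coordinate and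
vanish together only proportionally, `rebaseSimplePos_par_one`); for `B ≥ 2` the flats
`{h = w = 0}` (for `Hpar`) and `{κ = 0} ∩ {u(x', ℓ(x')) = 0}` (for the double corners) are
codimension-2 affine subspaces of the silent base `x' ∈ ℝ^B` meeting the closed cell — a point
for `B = 2`. Member of `HparFlat` at `B = 2`:
`[{0 < x₂ < x₁ < 1, 0 < y < x₁, y + 1 < t < y + 1 + x₂}, 1/(x₁² x₂ (y + 2) t)]`
(`h = x₁`, `w = x₂`, flat point `x' = 0`, where neither `h ≤ C w` nor `h ≥ η > 0` holds on any
neighbourhood).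

References: M. Kontsevich, D. Zagier, *Periods* (2001), §1.2, rules (1a), (2).
-/

noncomputable section

open Set MeasureTheory MvPolynomial
open Literature.NumberTheory.Transcendental Literature.ModelTheory.ExponentialFields

namespace Summit.KontsevichZagierPeriods.ArrangementNormalForm.JanusBands

namespace RebasePos

open SeparatePos

section Flats

variable {B m m' m₀ : ℕ} (L : Fin m → (Fin B → ℚ) × ℚ) (e : Fin m → ℕ) (ℓ₁ ℓ₂ : (Fin B → ℚ) × ℚ)

/-- **`Hpar` over a product cell whose closed cell does not meet the flat `{h = 0 = w}`.**
The data of `Hpar` (one lettered fibre, letter `0`, affine bounds `0 < u < v` parallel in `y`,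
base pole of order one) over a product cell `{x'-rows M₀} × (ylo(x'), yhi(x'))` (`hsec`) such
that no point of the closed cell `closure {rows > 0}` has `ylo = yhi` and `u = v` (`hnf`):
`[s]` is congruent modulo `KZ.relations` to the subgroup generated by `GG B 2 1`. See the
module docstring (extreme value theorem for `max (h, w)` on the closure of the domain, one cut
at a level of `h`, `good_parNonpinch'` far from the pinch and `good_parLevel` near it). -/
theorem good_parCell_of_noFlat (s : KZ.IntegralRep (B + 1 + 1)) (M : Fin m' → (Fin (B + 1) → ℚ) × ℚ)
    (M₀ : Fin m₀ → (Fin B → ℚ) × ℚ) (ylo yhi : (Fin B → ℚ) × ℚ) (p : MvPolynomial (Fin B) ℚ)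
    (u v : (Fin (B + 1) → ℚ) × ℚ) (hbd : Bornology.IsBounded s.domain)
    (hdom : s.domain = gDom B 1 m' M (fun _ => Sum.inr u) (fun _ => Sum.inr v))
    (hint : EqOn s.integrand (glit B 1 p L e ℓ₁ ℓ₂ 0 1 (fun _ => some 0)) s.domain)
    (hu : u.1 (Fin.last B) ≠ 0) (hpar : u.1 (Fin.last B) = v.1 (Fin.last B))
    (hcell : ∀ z : Fin (B + 1 + 1) → ℝ, (∀ j, 0 < affF B 1 (M j) z) →
      0 < affF B 1 u z ∧ affF B 1 u z < affF B 1 v z)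
    (hsec : ∀ z : Fin (B + 1 + 1) → ℝ, (∀ j, 0 < affF B 1 (M j) z) ↔ ((∀ j, 0 < affB B 1 (M₀ j) z) ∧
      affB B 1 ylo z < z (Fin.castAdd 1 (Fin.last B)) ∧ z (Fin.castAdd 1 (Fin.last B)) < affB B 1 yhi z))
    (hnf : ∀ z ∈ closure {z : Fin (B + 1 + 1) → ℝ | ∀ j, 0 < affF B 1 (M j) z},
      affB B 1 ylo z = affB B 1 yhi z → affF B 1 u z = affF B 1 v z → False) :
    ∃ c ∈ AddSubgroup.closure (GGset B 2 1), KZ.of s - c ∈ KZ.relations := by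
  -- height and width as `y`-free forms
  set s₀ : ℚ := u.1 (Fin.last B) with hs₀
  set hF : (Fin B → ℚ) × ℚ := yhi - ylo with hhF
  set wF : (Fin B → ℚ) × ℚ := restr B v - restr B u with hwF
  have hhz : ∀ z : Fin (B + 1 + 1) → ℝ, affB B 1 hF z = affB B 1 yhi z - affB B 1 ylo z :=
    fun z => by rw [hhF, affB_sub]
  have hwz : ∀ z : Fin (B + 1 + 1) → ℝ, affB B 1 wF z = affF B 1 v z - affF B 1 u z :=
    fun z => by rw [hwF, affB_sub, width_eq u v hpar]
  -- on the base cell the height and the width are positive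
  have hpos : ∀ z : Fin (B + 1 + 1) → ℝ, (∀ j, 0 < affF B 1 (M j) z) →
      0 < affB B 1 hF z ∧ 0 < affB B 1 wF z := fun z hz => by
    obtain ⟨-, hlo, hhi⟩ := (hsec z).1 hz
    obtain ⟨-, huv⟩ := hcell z hz
    rw [hhz, hwz]
    exact ⟨by linarith, by linarith⟩
  -- an empty base cell
  have hempty : (∀ z : Fin (B + 1 + 1) → ℝ, ¬ (∀ j, 0 < affF B 1 (M j) z)) →
      ∃ c ∈ AddSubgroup.closure (GGset B 2 1), KZ.of s - c ∈ KZ.relations := fun h => by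
    refine good_of_null s ?_
    rw [hdom]
    exact measure_mono_null (fun z hz => (h z ((mem_gDom_one M u v z).1 hz).1).elim) measure_empty
  -- the non-pinching case with an explicit `η`
  have hNP : ∀ η : ℝ, 0 < η → (∀ z : Fin (B + 1 + 1) → ℝ, (∀ j, 0 < affB B 1 (M₀ j) z) →
      η ≤ affB B 1 hF z) → ∃ c ∈ AddSubgroup.closure (GGset B 2 1), KZ.of s - c ∈ KZ.relations :=
    fun η hη h => good_parNonpinch' L e ℓ₁ ℓ₂ s M M₀ ylo yhi p u v hbd hdom hint hu hpar hcell hsec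
      ⟨η, hη, fun z hz => by rw [← hhz]; exact h z hz⟩
  -- constant height
  by_cases ha0 : hF.1 = 0
  · have hconst : ∀ z : Fin (B + 1 + 1) → ℝ, affB B 1 hF z = hF.2 := fun z => by
      simp [affB, ha0]
    by_cases hb0 : hF.2 ≤ 0
    · refine hempty fun z hz => ?_
      have h := (hpos z hz).1
      rw [hconst] at h
      have : ((hF.2 : ℚ) : ℝ) ≤ 0 := by exact_mod_cast hb0
      linarith
    · push Not at hb0
      exact hNP hF.2 (by exact_mod_cast hb0) fun z _ => (hconst z).ge
  -- the level `μ`: minimum of `max (h, w)` on the closure of the domain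
  have hdomhw : ∀ z ∈ s.domain, 0 < affB B 1 hF z ∧ 0 < affB B 1 wF z := fun z hz => by
    rw [hdom, mem_gDom_one] at hz
    exact hpos z hz.1
  set φ : (Fin (B + 1 + 1) → ℝ) → ℝ := fun z => max (affB B 1 hF z) (affB B 1 wF z) with hφ
  have hφc : Continuous φ := (continuous_affB_one hF).max (continuous_affB_one wF)
  have hK : IsCompact (closure s.domain) := hbd.isCompact_closure
  have hKsub : closure s.domain ⊆ closure {z : Fin (B + 1 + 1) → ℝ | ∀ j, 0 < affF B 1 (M j) z} :=
    closure_mono fun z hz => by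
      rw [hdom, mem_gDom_one] at hz
      exact hz.1
  have hKh : ∀ z ∈ closure s.domain, 0 ≤ affB B 1 hF z := fun z hz =>
    closure_minimal (fun z hz => ((hdomhw z hz).1.le : z ∈ {z | 0 ≤ affB B 1 hF z}))
      (isClosed_le continuous_const (continuous_affB_one hF)) hz
  have hKw : ∀ z ∈ closure s.domain, 0 ≤ affB B 1 wF z := fun z hz =>
    closure_minimal (fun z hz => ((hdomhw z hz).2.le : z ∈ {z | 0 ≤ affB B 1 wF z}))
      (isClosed_le continuous_const (continuous_affB_one wF)) hz
  have hφpos : ∀ z ∈ closure s.domain, 0 < φ z := fun z hz => by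
    by_contra hle
    push Not at hle
    have h1 : affB B 1 hF z = 0 := le_antisymm ((le_max_left _ _).trans hle) (hKh z hz)
    have h2 : affB B 1 wF z = 0 := le_antisymm ((le_max_right _ _).trans hle) (hKw z hz)
    rw [hhz, sub_eq_zero] at h1
    rw [hwz, sub_eq_zero] at h2
    exact hnf z (hKsub hz) h1.symm h2.symm
  rcases s.domain.eq_empty_or_nonempty with hemp | hne
  · exact good_of_null s (by rw [hemp, measure_empty])
  obtain ⟨z₀, hz₀, hmin⟩ := hK.exists_isMinOn hne.closure hφc.continuousOn
  set μ : ℝ := φ z₀ with hμ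
  have hμ0 : 0 < μ := hφpos z₀ hz₀
  have hμle : ∀ z ∈ closure s.domain, μ ≤ φ z := fun z hz => hmin hz
  -- where `h < μ` on the base cell, `μ ≤ w` (normalise `t` to the middle of the fibre)
  have hwlow : ∀ z : Fin (B + 1 + 1) → ℝ, (∀ j, 0 < affF B 1 (M j) z) → affB B 1 hF z < μ →
      μ ≤ affB B 1 wF z := by
    intro z hz hlt
    obtain ⟨-, huv⟩ := hcell z hz
    have hz'dom : Function.update z (tI B) ((affF B 1 u z + affF B 1 v z) / 2) ∈ s.domain := by
      rw [hdom, mem_gDom_one]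
      refine ⟨fun j => by rw [affF_update_tI]; exact hz j, ?_, ?_⟩
      · rw [affF_update_tI, show Fin.natAdd (B + 1) 0 = tI B from rfl, Function.update_self]
        linarith
      · rw [affF_update_tI, show Fin.natAdd (B + 1) 0 = tI B from rfl, Function.update_self]
        linarith
    have h := hμle _ (subset_closure hz'dom)
    rw [hφ] at h
    dsimp only at h
    rw [affB_update_tI, affB_update_tI] at h
    exact (le_max_iff.1 h).resolve_left (not_le.2 hlt)
  -- a rational cut level `0 < δ < μ` and the number of strips
  obtain ⟨δ, hδ0, hδμ⟩ := exists_rat_btwn hμ0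
  have hδ0' : (0 : ℚ) < δ := by exact_mod_cast hδ0
  set N : ℕ := ⌈|(s₀ : ℝ)| * δ / μ⌉₊ with hN
  have hNr : |(s₀ : ℝ)| * δ ≤ (N : ℝ) * μ := by
    have h := Nat.le_ceil (|(s₀ : ℝ)| * δ / μ)
    rw [← hN, div_le_iff₀ hμ0] at h
    exact h
  -- the cut at `h = δ` (rule 1a)
  set g : (Fin (B + 1) → ℚ) × ℚ := (((Fin.snoc (hF - ((0 : Fin B → ℚ), δ)).1 0 : Fin (B + 1) → ℚ),
    (hF - ((0 : Fin B → ℚ), δ)).2) : (Fin (B + 1) → ℚ) × ℚ) with hg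
  have hgz : ∀ z : Fin (B + 1 + 1) → ℝ, affF B 1 g z = affB B 1 hF z - δ := fun z => by
    rw [hg, affF_liftB, affB_sub, affB_const]
  have hgne : g ≠ 0 := by
    refine liftB_ne_zero fun h0 => ha0 ?_
    have := congrArg Prod.fst h0
    simpa using this
  obtain ⟨s₁, s₂, hm₁, hm₂, hi₁, hi₂, hd₁, hd₂, hrel⟩ := cutBase s M _ _ hdom g hgne
  have hsub₁ : s₁.domain ⊆ s.domain := fun z hz => ((hm₁ z).1 hz).1
  have hsub₂ : s₂.domain ⊆ s.domain := fun z hz => ((hm₂ z).1 hz).1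
  refine good_of_split hrel ?_ ?_
  · -- far part `h > δ`: non-pinching with `η = δ`
    refine good_parNonpinch' L e ℓ₁ ℓ₂ s₁ (Fin.snoc M g) (Fin.snoc M₀ (hF - ((0 : Fin B → ℚ), δ)))
      ylo yhi p u v (hbd.subset hsub₁) hd₁ (by rw [hi₁]; exact hint.mono hsub₁) hu hpar
      (fun z hz => hcell z (rows_snoc hz).1) (fun z => ?_) ⟨δ, hδ0, fun z hz => ?_⟩
    · rw [rowsF_snoc_iff, rowsB_snoc_iff, hsec, hgz, affB_sub hF, affB_const]
      constructor
      · rintro ⟨⟨h0, hlo, hhi⟩, hgt⟩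
        exact ⟨⟨h0, by linarith⟩, hlo, hhi⟩
      · rintro ⟨⟨h0, hgt⟩, hlo, hhi⟩
        exact ⟨⟨h0, hlo, hhi⟩, by linarith⟩
    · have h := (rowsB_snoc_iff.1 hz).2
      rw [affB_sub hF, affB_const, hhz] at h
      linarith
  · -- near part `h < δ`: `N + 1` strips of level splits
    refine good_parLevel L e ℓ₁ ℓ₂ 0 1 M₀ yhi p u v (Or.inl rfl) hpar N s₂ _ ylo (hbd.subset hsub₂)
      hd₂ (by rw [hi₂]; exact hint.mono hsub₂) (fun z hz => (hsec z).1 (rows_snoc hz).1) fun z hz => ?_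
    obtain ⟨hM, hneg⟩ := rows_snoc hz
    rw [affF_neg', hgz] at hneg
    have hlt : affB B 1 hF z < μ := by linarith
    have hw := hwlow z hM hlt
    rw [← hhz, ← hwz]
    calc |(u.1 (Fin.last B) : ℝ)| * affB B 1 hF z ≤ |(s₀ : ℝ)| * δ :=
          mul_le_mul_of_nonneg_left (by linarith) (abs_nonneg _)
      _ ≤ (N : ℝ) * μ := hNr
      _ ≤ (N : ℝ) * affB B 1 wF z := mul_le_mul_of_nonneg_left hw (Nat.cast_nonneg N)
      _ ≤ ((N : ℝ) + 1) * affB B 1 wF z := by linarith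

/-- **The residual hypothesis `Hpar` from its FLAT cells** (any base dimension `B + 1`). The
data of `Hpar` (one lettered fibre over a bounded base cell in `ℝ^{B+1}`, letter `0`, affine
bounds `0 < u < v` parallel in `y`, base factor `p(x')/∏ Lⱼ(x')^{eⱼ} · 1/(y − ℓ₂(x'))`) is
congruent modulo `KZ.relations` to the subgroup generated by `GG B 2 1` as soon as this holds
for its restrictions to the PRODUCT cells `{x'-rows M₀} × (ylo(x'), yhi(x'))` of the base cell
whose closed cell `closure {rows > 0}` MEETS THE FLAT `{ylo = yhi} ∩ {u = v}` (`Hflat`):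
`par_cells` + `good_parCell_of_noFlat`. -/
theorem good_par_of_flat (s : KZ.IntegralRep (B + 1 + 1)) (M : Fin m' → (Fin (B + 1) → ℚ) × ℚ)
    (p : MvPolynomial (Fin B) ℚ) (u v : (Fin (B + 1) → ℚ) × ℚ) (hbd : Bornology.IsBounded s.domain)
    (hdom : s.domain = gDom B 1 m' M (fun _ => Sum.inr u) (fun _ => Sum.inr v))
    (hint : EqOn s.integrand (glit B 1 p L e ℓ₁ ℓ₂ 0 1 (fun _ => some 0)) s.domain)
    (hu : u.1 (Fin.last B) ≠ 0) (hpar : u.1 (Fin.last B) = v.1 (Fin.last B))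
    (hcell : ∀ z : Fin (B + 1 + 1) → ℝ, (∀ j, 0 < affF B 1 (M j) z) →
      0 < affF B 1 u z ∧ affF B 1 u z < affF B 1 v z)
    (Hflat : ∀ (m'' m₀ : ℕ) (s' : KZ.IntegralRep (B + 1 + 1)) (M' : Fin m'' → (Fin (B + 1) → ℚ) × ℚ)
      (M₀ : Fin m₀ → (Fin B → ℚ) × ℚ) (ylo yhi : (Fin B → ℚ) × ℚ), Bornology.IsBounded s'.domain →
      s'.domain = gDom B 1 m'' M' (fun _ => Sum.inr u) (fun _ => Sum.inr v) →
      EqOn s'.integrand (glit B 1 p L e ℓ₁ ℓ₂ 0 1 (fun _ => some 0)) s'.domain →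
      (∀ z : Fin (B + 1 + 1) → ℝ, (∀ j, 0 < affF B 1 (M' j) z) →
        0 < affF B 1 u z ∧ affF B 1 u z < affF B 1 v z) →
      (∀ z : Fin (B + 1 + 1) → ℝ, (∀ j, 0 < affF B 1 (M' j) z) ↔ ((∀ j, 0 < affB B 1 (M₀ j) z) ∧
        affB B 1 ylo z < z (Fin.castAdd 1 (Fin.last B)) ∧ z (Fin.castAdd 1 (Fin.last B)) < affB B 1 yhi z)) →
      (∃ z ∈ closure {z : Fin (B + 1 + 1) → ℝ | ∀ j, 0 < affF B 1 (M' j) z},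
        affB B 1 ylo z = affB B 1 yhi z ∧ affF B 1 u z = affF B 1 v z) →
      ∃ c ∈ AddSubgroup.closure (GGset B 2 1), KZ.of s' - c ∈ KZ.relations) :
    ∃ c ∈ AddSubgroup.closure (GGset B 2 1), KZ.of s - c ∈ KZ.relations :=
  par_cells s M u v hbd hdom fun m'' m₀ s' M' M₀ ylo yhi hsub hi' hd' hsec hbase => by
    by_cases hfl : ∃ z ∈ closure {z : Fin (B + 1 + 1) → ℝ | ∀ j, 0 < affF B 1 (M' j) z},
        affB B 1 ylo z = affB B 1 yhi z ∧ affF B 1 u z = affF B 1 v z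
    · exact Hflat m'' m₀ s' M' M₀ ylo yhi (hbd.subset hsub) hd' (by rw [hi']; exact hint.mono hsub)
        (fun z hz => hcell z (hbase z hz)) hsec hfl
    · push Not at hfl
      exact good_parCell_of_noFlat L e ℓ₁ ℓ₂ s' M' M₀ ylo yhi p u v (hbd.subset hsub) hd'
        (by rw [hi']; exact hint.mono hsub) hu hpar (fun z hz => hcell z (hbase z hz)) hsec
        fun z hz h1 h2 => hfl z hz h1 h2

end Flats

end RebasePos

/-- **Registered part of `stub_rebaseSimplePosOnePos` (line `janus-bands`): the residual
hypothesis `Hpar` of the one-fibre rebase from its FLAT product cells, any base dimension.**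
The data of `Hpar` (one lettered fibre over a bounded base cell in `ℝ^{B+1}`, letter `0`,
affine bounds `0 < u < v` PARALLEL in `y` with common slope `u_y ≠ 0`, base factor
`p(x')/∏ Lⱼ(x')^{eⱼ} · 1/(y − ℓ₂(x'))`): `[s]` is congruent modulo `KZ.relations` to the
subgroup generated by the literal class `GG B 2 1` AS SOON AS this holds for the restrictions
to the product cells `{x'-rows M₀} × (ylo(x'), yhi(x'))` (`hsec`) of the base cell whose closed
cell contains a point with `ylo = yhi` AND `u = v` (`Hflat`: the cell meets the codimension-2
flat `{h = 0} ∩ {w = 0}` of the silent base, `h = yhi − ylo` the height of the `y`-range,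
`w = v − u` the `y`-free width). All other cells are closed by `rebaseSimplePos_par_cells`,
the extreme value theorem for `max (h, w)` on the compact closure of the domain, one cut at a
rational level of `h` (rule 1a), `rebaseSimplePos_par_nonpinch` on the far part and
`rebaseSimplePos_par_level` on the near part (`RebasePos.good_par_of_flat`). -/
theorem rebaseSimplePos_par_of_flat (B m m' : ℕ) (s : KZ.IntegralRep (B + 1 + 1)) (M : Fin m' → (Fin (B + 1) → ℚ) × ℚ) (L : Fin m → (Fin B → ℚ) × ℚ) (e : Fin m → ℕ) (p : MvPolynomial (Fin B) ℚ) (ℓ₁ ℓ₂ : (Fin B → ℚ) × ℚ) (u v : (Fin (B + 1) → ℚ) × ℚ) (hbd : Bornology.IsBounded s.domain) (hdom : s.domain = SeparatePos.gDom B 1 m' M (fun _ => Sum.inr u) (fun _ => Sum.inr v)) (hint : Set.EqOn s.integrand (RebasePos.glit B 1 p L e ℓ₁ ℓ₂ 0 1 (fun _ => some 0)) s.domain) (hu : u.1 (Fin.last B) ≠ 0) (hpar : u.1 (Fin.last B) = v.1 (Fin.last B)) (hcell : ∀ z : Fin (B + 1 + 1) → ℝ, (∀ j, 0 < SeparatePos.affF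 B 1 (M j) z) → 0 < SeparatePos.affF B 1 u z ∧ SeparatePos.affF B 1 u z < SeparatePos.affF B 1 v z) (Hflat : ∀ (m'' m₀ : ℕ) (s' : KZ.IntegralRep (B + 1 + 1)) (M' : Fin m'' → (Fin (B + 1) → ℚ) × ℚ) (M₀ : Fin m₀ → (Fin B → ℚ) × ℚ) (ylo yhi : (Fin B → ℚ) × ℚ), Bornology.IsBounded s'.domain → s'.domain = SeparatePos.gDom B 1 m'' M' (fun _ => Sum.inr u) (fun _ => Sum.inr v) → EqOn s'.integrand (RebasePos.glit B 1 p L e ℓ₁ ℓ₂ 0 1 (fun _ => some 0)) s'.domain → (∀ z : Fin (B + 1 + 1) → ℝ, (∀ j, 0 < SeparatePos.affF B 1 (M' j) z) → 0 < SeparatePos.affF B 1 u z ∧ SeparatePos.affF B 1 u z < SeparatePos.affF B 1 v z) → (∀ z : Fin (B + 1 + 1) → ℝ, (∀ j, 0 < SeparatePos.affF B 1 (M' j) z) ↔ ((∀ j, 0 < SeparatePos.affB B 1 (M₀ j) z) ∧ SeparatePos.affB B 1 ylo z < z (Fin.castAdd 1 (Fin.last B)) ∧ z (Fin.castAdd 1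 (Fin.last B)) < SeparatePos.affB B 1 yhi z)) → (∃ z ∈ closure {z : Fin (B + 1 + 1) → ℝ | ∀ j, 0 < SeparatePos.affF B 1 (M' j) z}, SeparatePos.affB B 1 ylo z = SeparatePos.affB B 1 yhi z ∧ SeparatePos.affF B 1 u z = SeparatePos.affF B 1 v z) → ∃ c ∈ AddSubgroup.closure (SeparatePos.GGset B 2 1), KZ.of s' - c ∈ KZ.relations) : ∃ c ∈ AddSubgroup.closure (SeparatePos.GGset B 2 1), KZ.of s - c ∈ KZ.relations :=
  RebasePos.good_par_of_flat L e ℓ₁ ℓ₂ s M p u v hbd hdom hint hu hpar hcell Hflat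

/-- **Registered part of `stub_rebaseSimplePosOnePos` (line `janus-bands`): the one-fibre
rebase from FLAT parallel bands and DOUBLE-corner bands** (literal one-fibre data over a base
of dimension `B + 1`, any bounds, any letter, exponents `n₁ = 0`, `n₂ = 1`): IF, for the base
poles `ℓ₂` and `0`, the parallel transverse bands over product cells whose closed cell meets
the flat `{ylo = yhi} ∩ {u = v}` (`HparFlat`) and the double-corner bands (`Hdthick`, `Hdfar`,
verbatim from `rebaseSimplePos_oneFibre_of_double`) are congruent to the subgroup generated by
`GG B 2 1`, THEN so is `[s]` (`rebaseSimplePos_oneFibre_of_double` fed with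
`RebasePos.good_par_of_flat`). -/
theorem rebaseSimplePos_oneFibre_of_flats (B m m' : ℕ) (s : KZ.IntegralRep (B + 1 + 1)) (M : Fin m' → (Fin (B + 1) → ℚ) × ℚ) (L : Fin m → (Fin B → ℚ) × ℚ) (e : Fin m → ℕ) (p : MvPolynomial (Fin B) ℚ) (ℓ₁ ℓ₂ : (Fin B → ℚ) × ℚ) (a : Fin 1 → Option ((Fin (B + 1) → ℚ) × ℚ)) (lo hi : Fin 1 → Fin 1 ⊕ ((Fin (B + 1) → ℚ) × ℚ)) (hbd : Bornology.IsBounded s.domain) (hdom : s.domain = SeparatePos.gDom B 1 m' M lo hi) (hint : EqOn s.integrand (RebasePos.glit B 1 p L e ℓ₁ ℓ₂ 0 1 a) s.domain) (HparFlat : ∀ (ℓ : (Fin B → ℚ) × ℚ), (ℓ = ℓ₂ ∨ ℓ = 0) → ∀ (m' m₀ : ℕ) (s : KZ.IntegralRep (B + 1 + 1)) (M : Fin m' → (Fin (B + 1) → ℚ) × ℚ) (M₀ : Fin m₀ → (Fin B → ℚ) × ℚ) (ylo yhi : (Fin B → ℚ) × ℚ) (p : MvPolynomial (Fin B) ℚ)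 (u v : (Fin (B + 1) → ℚ) × ℚ), Bornology.IsBounded s.domain → s.domain = SeparatePos.gDom B 1 m' M (fun _ => Sum.inr u) (fun _ => Sum.inr v) → EqOn s.integrand (RebasePos.glit B 1 p L e ℓ₁ ℓ 0 1 (fun _ => some 0)) s.domain → u.1 (Fin.last B) ≠ 0 → u.1 (Fin.last B) = v.1 (Fin.last B) → (∀ z : Fin (B + 1 + 1) → ℝ, (∀ j, 0 < SeparatePos.affF B 1 (M j) z) → 0 < SeparatePos.affF B 1 u z ∧ SeparatePos.affF B 1 u z < SeparatePos.affF B 1 v z) → (∀ z : Fin (B + 1 + 1) → ℝ, (∀ j, 0 < SeparatePos.affF B 1 (M j) z) ↔ ((∀ j, 0 < SeparatePos.affB B 1 (M₀ j) z) ∧ SeparatePos.affB B 1 ylo z < z (Fin.castAdd 1 (Fin.last B)) ∧ z (Fin.castAdd 1 (Fin.last B)) < SeparatePos.affB B 1 yhi z)) → (∃ z ∈ closure {z : Fin (B + 1 + 1) → ℝ | ∀ j, 0 < SeparatePos.affF B 1 (M j) z}, SeparatePos.affB B 1 ylo z = SeparatePos.affB B 1 yhi z ∧ SeparatePos.affF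 B 1 u z = SeparatePos.affF B 1 v z) → ∃ c ∈ AddSubgroup.closure (SeparatePos.GGset B 2 1), KZ.of s - c ∈ KZ.relations) (Hdthick : ∀ (ℓ : (Fin B → ℚ) × ℚ), (ℓ = ℓ₂ ∨ ℓ = 0) → ∀ (m' : ℕ) (s : KZ.IntegralRep (B + 1 + 1)) (M : Fin m' → (Fin (B + 1) → ℚ) × ℚ) (p : MvPolynomial (Fin B) ℚ) (u v κ : (Fin (B + 1) → ℚ) × ℚ) (A : ℚ), Bornology.IsBounded s.domain → s.domain = SeparatePos.gDom B 1 m' M (fun _ => Sum.inr u) (fun _ => Sum.inr v) → EqOn s.integrand (RebasePos.glit B 1 p L e ℓ₁ ℓ 0 1 (fun _ => some 0)) s.domain → κ.1 (Fin.last B) = 0 → u - κ = A • (v - u) → 0 < A → (∀ z : Fin (B + 1 + 1) → ℝ, (∀ j, 0 < SeparatePos.affF B 1 (M j) z) → SeparatePos.affF B 1 κ z < 0 ∧ 0 < SeparatePos.affF B 1 u z ∧ SeparatePos.affF B 1 u z < SeparatePos.affF B 1 v z) → (∃ z ∈ closure {z : Fin (B + 1 + 1) → ℝ | ∀ j, 0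 < SeparatePos.affF B 1 (M j) z}, SeparatePos.affF B 1 κ z = 0 ∧ SeparatePos.affF B 1 u z = 0 ∧ SeparatePos.affF B 1 v z = 0 ∧ z (Fin.castAdd 1 (Fin.last B)) = SeparatePos.affB B 1 ℓ z) → ∃ c ∈ AddSubgroup.closure (SeparatePos.GGset B 2 1), KZ.of s - c ∈ KZ.relations) (Hdfar : ∀ (ℓ : (Fin B → ℚ) × ℚ), (ℓ = ℓ₂ ∨ ℓ = 0) → ∀ (m' : ℕ) (s : KZ.IntegralRep (B + 1 + 1)) (M : Fin m' → (Fin (B + 1) → ℚ) × ℚ) (p : MvPolynomial (Fin B) ℚ) (u v κ : (Fin (B + 1) → ℚ) × ℚ) (A : ℚ), Bornology.IsBounded s.domain → s.domain = SeparatePos.gDom B 1 m' M (fun _ => Sum.inr u) (fun _ => Sum.inr v) → EqOn s.integrand (RebasePos.glit B 1 p L e ℓ₁ ℓ 0 1 (fun _ => some 0)) s.domain → κ.1 (Fin.last B) = 0 → u - κ = A • (v - u) → 0 < A → (∀ z : Fin (B + 1 + 1) → ℝ, (∀ j, 0 < SeparatePos.affF B 1 (M j) z) → 0 < SeparatePos.affF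 B 1 κ z ∧ SeparatePos.affF B 1 u z < SeparatePos.affF B 1 v z ∧ 2 * SeparatePos.affF B 1 κ z ≤ SeparatePos.affF B 1 v z) → (∃ z ∈ closure {z : Fin (B + 1 + 1) → ℝ | ∀ j, 0 < SeparatePos.affF B 1 (M j) z}, SeparatePos.affF B 1 κ z = 0 ∧ SeparatePos.affF B 1 u z = 0 ∧ SeparatePos.affF B 1 v z = 0 ∧ z (Fin.castAdd 1 (Fin.last B)) = SeparatePos.affB B 1 ℓ z) → ∃ c ∈ AddSubgroup.closure (SeparatePos.GGset B 2 1), KZ.of s - c ∈ KZ.relations) : ∃ c ∈ AddSubgroup.closure (SeparatePos.GGset B 2 1), KZ.of s - c ∈ KZ.relations :=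
  rebaseSimplePos_oneFibre_of_double B m m' s M L e p ℓ₁ ℓ₂ a lo hi hbd hdom hint
    (fun ℓ hℓ _ s M p u v hbd hdom hint hu hpar hcell =>
      RebasePos.good_par_of_flat L e ℓ₁ ℓ s M p u v hbd hdom hint hu hpar hcell
        fun m'' m₀ s' M' M₀ ylo yhi hbd' hd' hi' hcell' hsec hfl =>
          HparFlat ℓ hℓ m'' m₀ s' M' M₀ ylo yhi p u v hbd' hd' hi' hu hpar hcell' hsec hfl)
    Hdthick Hdfar

/-- **The stub `stub_rebaseSimplePosOnePos` reduced to the degeneration flats** (exactly its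
signature plus `HparFlat`, `Hdthick`, `Hdfar` at `B = b + 2`, quantified over all parameters
`m L e ℓ₁ ℓ₂`): `GS (b+2) 1 → closure (GG (b+2) 2 1 ∪ JJ (b+2) 2 ∪ JD (b+3))` modulo
`KZ.relations`. `HparFlat`: parallel transverse bands over a product cell
`{x'-rows M₀} × (ylo(x'), yhi(x'))` whose closed cell meets the flat `{ylo = yhi} ∩ {u = v}`;
`Hdthick` / `Hdfar`: bands above their `y`-free apex level `κ` (`u − κ = A (v − u)`, `A > 0`)
in the thick resp. far regime whose closed cell contains a corner point `κ = u = v = 0` on the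
pole hyperplane `y = ℓ₂(x')` (the hypotheses of `rebaseSimplePos_oneFibre_of_double'` at
`b + 1`). Everything else is discharged by the landed B-generic case tree; the target is
embedded by `AddSubgroup.closure_mono`. -/
theorem rebaseSimplePosOnePos_of_flats' (GS : ℕ → ℕ → Set KZ.FormalRep) (GG : ℕ → ℕ → ℕ → Set KZ.FormalRep) (hGS : ∀ b k, GS b k = {w : KZ.FormalRep | ∃ (m m' n₁ n₂ : ℕ) (s : KZ.IntegralRep (b + 1 + k)) (M : Fin m' → (Fin (b + 1) → ℚ) × ℚ) (L : Fin m → (Fin b → ℚ) × ℚ) (e : Fin m → ℕ) (p : MvPolynomial (Fin b) ℚ) (ℓ₁ ℓ₂ : (Fin b → ℚ) × ℚ) (a : Fin k → Option ((Fin (b + 1) → ℚ) × ℚ)) (lo hi : Fin k → Fin k ⊕ ((Fin (b + 1) → ℚ) × ℚ)), (n₁ = 0 ∨ n₂ = 0) ∧ n₂ = 1 ∧ Bornology.IsBounded s.domain ∧ s.domain = {z | (∀ j, 0 < ∑ i, ((M j).1 i : ℝ) * z (Fin.castAdd k i) + ((M j).2 : ℝ)) ∧ ∀ i, Sum.elim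 (fun j => z (Fin.natAdd (b + 1) j)) (fun c => ∑ i', (c.1 i' : ℝ) * z (Fin.castAdd k i') + (c.2 : ℝ)) (lo i) < z (Fin.natAdd (b + 1) i) ∧ z (Fin.natAdd (b + 1) i) < Sum.elim (fun j => z (Fin.natAdd (b + 1) j)) (fun c => ∑ i', (c.1 i' : ℝ) * z (Fin.castAdd k i') + (c.2 : ℝ)) (hi i)} ∧ EqOn s.integrand (fun z => MvPolynomial.aeval (fun i => z (Fin.castAdd k (Fin.castSucc i))) p / (∏ j, (∑ i, ((L j).1 i : ℝ) * z (Fin.castAdd k (Fin.castSucc i)) + ((L j).2 : ℝ)) ^ e j) * ((z (Fin.castAdd k (Fin.last b)) - (∑ i, (ℓ₁.1 i : ℝ) * z (Fin.castAdd k (Fin.castSucc i)) + (ℓ₁.2 : ℝ))) ^ n₁ / (z (Fin.castAdd k (Fin.last b)) - (∑ i, (ℓ₂.1 i : ℝ) * z (Fin.castAdd k (Fin.castSucc i)) + (ℓ₂.2 : ℝ))) ^ n₂) * ∏ i, (a i).elim 1 (fun c => 1 / (z (Fin.natAdd (b + 1) i) - (∑ i', (c.1 i' : ℝ) * z (Fin.castAdd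 k i') + (c.2 : ℝ))))) s.domain ∧ w = KZ.of s}) (hGG : ∀ b σ k, GG b σ k = {w : KZ.FormalRep | ∃ (m m' n₁ n₂ : ℕ) (s : KZ.IntegralRep (b + 1 + k)) (M : Fin m' → (Fin (b + 1) → ℚ) × ℚ) (L : Fin m → (Fin b → ℚ) × ℚ) (e : Fin m → ℕ) (p : MvPolynomial (Fin b) ℚ) (ℓ₁ ℓ₂ : (Fin b → ℚ) × ℚ) (a : Fin k → Option ((Fin (b + 1) → ℚ) × ℚ)) (lo hi : Fin k → Fin k ⊕ ((Fin (b + 1) → ℚ) × ℚ)), (n₁ = 0 ∨ n₂ = 0) ∧ (σ = 2 → (∀ i c, a i = some c → c.1 (Fin.last b) = 0) ∧ (∀ i c, (lo i = Sum.inr c ∨ hi i = Sum.inr c) → (c.1 (Fin.last b) = 0 ∨ c = (Pi.single (Fin.last b) 1, 0)))) ∧ Bornology.IsBounded s.domain ∧ s.domain = {z | (∀ j, 0 < ∑ i, ((M j).1 i : ℝ) * z (Fin.castAdd k i) + ((M j).2 : ℝ)) ∧ ∀ i, Sum.elim (fun j => z (Fin.natAdd (b + 1) j)) (fun c => ∑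 i', (c.1 i' : ℝ) * z (Fin.castAdd k i') + (c.2 : ℝ)) (lo i) < z (Fin.natAdd (b + 1) i) ∧ z (Fin.natAdd (b + 1) i) < Sum.elim (fun j => z (Fin.natAdd (b + 1) j)) (fun c => ∑ i', (c.1 i' : ℝ) * z (Fin.castAdd k i') + (c.2 : ℝ)) (hi i)} ∧ EqOn s.integrand (fun z => MvPolynomial.aeval (fun i => z (Fin.castAdd k (Fin.castSucc i))) p / (∏ j, (∑ i, ((L j).1 i : ℝ) * z (Fin.castAdd k (Fin.castSucc i)) + ((L j).2 : ℝ)) ^ e j) * ((z (Fin.castAdd k (Fin.last b)) - (∑ i, (ℓ₁.1 i : ℝ) * z (Fin.castAdd k (Fin.castSucc i)) + (ℓ₁.2 : ℝ))) ^ n₁ / (z (Fin.castAdd k (Fin.last b)) - (∑ i, (ℓ₂.1 i : ℝ) * z (Fin.castAdd k (Fin.castSucc i)) + (ℓ₂.2 : ℝ))) ^ n₂) * ∏ i, (a i).elim 1 (fun c => 1 / (z (Fin.natAdd (b + 1) i) - (∑ i', (c.1 i' : ℝ) * z (Fin.castAdd k i') + (c.2 : ℝ))))) s.domain ∧ w =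 KZ.of s}) (JJ : ℕ → ℕ → Set KZ.FormalRep) (JD : ℕ → Set KZ.FormalRep) (hJJ : ∀ b k, JJ b k = {w : KZ.FormalRep | ∃ (m m' : ℕ) (s : KZ.IntegralRep (b + k)) (M : Fin m' → (Fin b → ℚ) × ℚ) (L : Fin m → (Fin b → ℚ) × ℚ) (e : Fin m → ℕ) (p : MvPolynomial (Fin b) ℚ) (a : Fin k → Option ((Fin b → ℚ) × ℚ)) (lo hi : Fin k → Fin k ⊕ ((Fin b → ℚ) × ℚ)), Bornology.IsBounded s.domain ∧ s.domain = {z | (∀ j, 0 < ∑ i, ((M j).1 i : ℝ) * z (Fin.castAdd k i) + ((M j).2 : ℝ)) ∧ ∀ i, Sum.elim (fun j => z (Fin.natAdd b j)) (fun c => ∑ i', (c.1 i' : ℝ) * z (Fin.castAdd k i') + (c.2 : ℝ)) (lo i) < z (Fin.natAdd b i) ∧ z (Fin.natAdd b i) < Sum.elim (fun j => z (Fin.natAdd b j)) (fun c => ∑ i', (c.1 i' : ℝ) * z (Fin.castAdd k i') + (c.2 : ℝ)) (hi i)} ∧ EqOn s.integrand (fun z => MvPolynomial.aeval (fun i =>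 z (Fin.castAdd k i)) p / (∏ j, (∑ i, ((L j).1 i : ℝ) * z (Fin.castAdd k i) + ((L j).2 : ℝ)) ^ e j) * ∏ i, (a i).elim 1 (fun c => 1 / (z (Fin.natAdd b i) - (∑ i', (c.1 i' : ℝ) * z (Fin.castAdd k i') + (c.2 : ℝ))))) s.domain ∧ w = KZ.of s}) (hJD : ∀ N, JD N = {w : KZ.FormalRep | ∃ b' k', b' + k' = N ∧ w ∈ JJ b' k'}) (b : ℕ) (HparFlat : ∀ (m : ℕ) (L : Fin m → (Fin (b + 1 + 1) → ℚ) × ℚ) (e : Fin m → ℕ) (ℓ₁ ℓ₂ : (Fin (b + 1 + 1) → ℚ) × ℚ) (m' m₀ : ℕ) (s : KZ.IntegralRep (b + 1 + 1 + 1 + 1)) (M : Fin m' → (Fin (b + 1 + 1 + 1) → ℚ) × ℚ) (M₀ : Fin m₀ → (Fin (b + 1 + 1) → ℚ) × ℚ) (ylo yhi : (Fin (b + 1 + 1) → ℚ) × ℚ) (p : MvPolynomial (Fin (b + 1 + 1)) ℚ) (u v : (Fin (b + 1 + 1 + 1) → ℚ) × ℚ), Bornology.IsBounded s.domain → s.domain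 = SeparatePos.gDom (b + 1 + 1) 1 m' M (fun _ => Sum.inr u) (fun _ => Sum.inr v) → EqOn s.integrand (RebasePos.glit (b + 1 + 1) 1 p L e ℓ₁ ℓ₂ 0 1 (fun _ => some 0)) s.domain → u.1 (Fin.last (b + 1 + 1)) ≠ 0 → u.1 (Fin.last (b + 1 + 1)) = v.1 (Fin.last (b + 1 + 1)) → (∀ z : Fin (b + 1 + 1 + 1 + 1) → ℝ, (∀ j, 0 < SeparatePos.affF (b + 1 + 1) 1 (M j) z) → 0 < SeparatePos.affF (b + 1 + 1) 1 u z ∧ SeparatePos.affF (b + 1 + 1) 1 u z < SeparatePos.affF (b + 1 + 1) 1 v z) → (∀ z : Fin (b + 1 + 1 + 1 + 1) → ℝ, (∀ j, 0 < SeparatePos.affF (b + 1 + 1) 1 (M j) z) ↔ ((∀ j, 0 < SeparatePos.affB (b + 1 + 1) 1 (M₀ j) z) ∧ SeparatePos.affB (b + 1 + 1) 1 ylo z < z (Fin.castAdd 1 (Fin.last (b + 1 + 1))) ∧ z (Fin.castAdd 1 (Fin.last (b + 1 + 1))) < SeparatePos.affB (b + 1 + 1) 1 yhi z)) → (∃ z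 ∈ closure {z : Fin (b + 1 + 1 + 1 + 1) → ℝ | ∀ j, 0 < SeparatePos.affF (b + 1 + 1) 1 (M j) z}, SeparatePos.affB (b + 1 + 1) 1 ylo z = SeparatePos.affB (b + 1 + 1) 1 yhi z ∧ SeparatePos.affF (b + 1 + 1) 1 u z = SeparatePos.affF (b + 1 + 1) 1 v z) → ∃ c ∈ AddSubgroup.closure (SeparatePos.GGset (b + 1 + 1) 2 1), KZ.of s - c ∈ KZ.relations) (Hdthick : ∀ (m : ℕ) (L : Fin m → (Fin (b + 1 + 1) → ℚ) × ℚ) (e : Fin m → ℕ) (ℓ₁ ℓ₂ : (Fin (b + 1 + 1) → ℚ) × ℚ), ∀ (m' : ℕ) (s : KZ.IntegralRep (b + 1 + 1 + 1 + 1)) (M : Fin m' → (Fin (b + 1 + 1 + 1) → ℚ) × ℚ) (p : MvPolynomial (Fin (b + 1 + 1)) ℚ) (u v κ : (Fin (b + 1 + 1 + 1) → ℚ) × ℚ) (A : ℚ), Bornology.IsBounded s.domain → s.domain = SeparatePos.gDom (b + 1 + 1) 1 m' M (fun _ => Sum.inr u) (fun _ => Sum.inr v) → EqOn s.integrand (RebasePos.glit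 (b + 1 + 1) 1 p L e ℓ₁ ℓ₂ 0 1 (fun _ => some 0)) s.domain → κ.1 (Fin.last (b + 1 + 1)) = 0 → u - κ = A • (v - u) → 0 < A → (∀ z : Fin (b + 1 + 1 + 1 + 1) → ℝ, (∀ j, 0 < SeparatePos.affF (b + 1 + 1) 1 (M j) z) → SeparatePos.affF (b + 1 + 1) 1 κ z < 0 ∧ 0 < SeparatePos.affF (b + 1 + 1) 1 u z ∧ SeparatePos.affF (b + 1 + 1) 1 u z < SeparatePos.affF (b + 1 + 1) 1 v z) → (∃ z ∈ closure {z : Fin (b + 1 + 1 + 1 + 1) → ℝ | ∀ j, 0 < SeparatePos.affF (b + 1 + 1) 1 (M j) z}, SeparatePos.affF (b + 1 + 1) 1 κ z = 0 ∧ SeparatePos.affF (b + 1 + 1) 1 u z = 0 ∧ SeparatePos.affF (b + 1 + 1) 1 v z = 0 ∧ z (Fin.castAdd 1 (Fin.last (b + 1 + 1))) = SeparatePos.affB (b + 1 + 1) 1 ℓ₂ z) → ∃ c ∈ AddSubgroup.closure (SeparatePos.GGset (b + 1 + 1) 2 1), KZ.of s - c ∈ KZ.relations) (Hdfar : ∀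 (m : ℕ) (L : Fin m → (Fin (b + 1 + 1) → ℚ) × ℚ) (e : Fin m → ℕ) (ℓ₁ ℓ₂ : (Fin (b + 1 + 1) → ℚ) × ℚ), ∀ (m' : ℕ) (s : KZ.IntegralRep (b + 1 + 1 + 1 + 1)) (M : Fin m' → (Fin (b + 1 + 1 + 1) → ℚ) × ℚ) (p : MvPolynomial (Fin (b + 1 + 1)) ℚ) (u v κ : (Fin (b + 1 + 1 + 1) → ℚ) × ℚ) (A : ℚ), Bornology.IsBounded s.domain → s.domain = SeparatePos.gDom (b + 1 + 1) 1 m' M (fun _ => Sum.inr u) (fun _ => Sum.inr v) → EqOn s.integrand (RebasePos.glit (b + 1 + 1) 1 p L e ℓ₁ ℓ₂ 0 1 (fun _ => some 0)) s.domain → κ.1 (Fin.last (b + 1 + 1)) = 0 → u - κ = A • (v - u) → 0 < A → (∀ z : Fin (b + 1 + 1 + 1 + 1) → ℝ, (∀ j, 0 < SeparatePos.affF (b + 1 + 1) 1 (M j) z) → 0 < SeparatePos.affF (b + 1 + 1) 1 κ z ∧ SeparatePos.affF (b + 1 + 1) 1 u z < SeparatePos.affF (b + 1 + 1) 1 v z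 ∧ 2 * SeparatePos.affF (b + 1 + 1) 1 κ z ≤ SeparatePos.affF (b + 1 + 1) 1 v z) → (∃ z ∈ closure {z : Fin (b + 1 + 1 + 1 + 1) → ℝ | ∀ j, 0 < SeparatePos.affF (b + 1 + 1) 1 (M j) z}, SeparatePos.affF (b + 1 + 1) 1 κ z = 0 ∧ SeparatePos.affF (b + 1 + 1) 1 u z = 0 ∧ SeparatePos.affF (b + 1 + 1) 1 v z = 0 ∧ z (Fin.castAdd 1 (Fin.last (b + 1 + 1))) = SeparatePos.affB (b + 1 + 1) 1 ℓ₂ z) → ∃ c ∈ AddSubgroup.closure (SeparatePos.GGset (b + 1 + 1) 2 1), KZ.of s - c ∈ KZ.relations) : ∀ x ∈ GS (b + 2) 1, ∃ c ∈ AddSubgroup.closure (GG (b + 2) 2 1 ∪ JJ (b + 2) 2 ∪ JD (b + 3)), x - c ∈ KZ.relations := by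
  intro x hx
  have _hJJ := hJJ
  have _hJD := hJD
  obtain ⟨c, hc, hxc⟩ := rebaseSimplePos_oneFibre_of_double' GS GG hGS hGG (b + 1)
    (fun m L e ℓ₁ ℓ₂ _ s M p u v hbd hdom hint hu hpar hcell =>
      RebasePos.good_par_of_flat L e ℓ₁ ℓ₂ s M p u v hbd hdom hint hu hpar hcell
        fun m'' m₀ s' M' M₀ ylo yhi hbd' hd' hi' hcell' hsec hfl =>
          HparFlat m L e ℓ₁ ℓ₂ m'' m₀ s' M' M₀ ylo yhi p u v hbd' hd' hi' hu hpar hcell' hsec hfl)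
    Hdthick Hdfar x hx
  exact ⟨c, AddSubgroup.closure_mono (subset_union_left.trans subset_union_left) hc, hxc⟩

end Summit.KontsevichZagierPeriods.ArrangementNormalForm.JanusBands
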